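import Mathlib
import Summits.Ventures.PercRepro2.Defs
import Summits.Ventures.PercRepro2.Independence
import Summits.Ventures.PercRepro2.Harris
import Summits.Ventures.PercRepro2.Graph
import Summits.Ventures.PercRepro2.Exploration
import Summits.Ventures.PercRepro2.Events
import Summits.Ventures.PercRepro2.Induced
import Summits.Ventures.PercRepro2.R2PrimeThreeReduction
import Summits.Ventures.PercRepro2.YBridge
import Summits.Ventures.PercRepro2.HCov
import Summits.Ventures.PercRepro2.HubModel
import Summits.Ventures.PercRepro2.HubModel3
import Summits.Ventures.PercRepro2.HubLaw3
import Summits.Ventures.PercRepro2.HubPat3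
import Summits.Ventures.PercRepro2.HubHarris3
import Summits.Ventures.PercRepro2.HubBundle3
import Summits.Ventures.PercRepro2.HubEvents3
import Summits.Ventures.PercRepro2.HubBern3
import Summits.Ventures.PercRepro2.HubGc3
import Summits.Ventures.PercRepro2.HubKron3
import Summits.Ventures.PercRepro2.HubTab3
import Summits.Ventures.PercRepro2.HubTab3Data1
import Summits.Ventures.PercRepro2.HubTab3Data2
import Summits.Ventures.PercRepro2.HubTab3Data3
import Summits.Ventures.PercRepro2.HubTab3Data4
import Summits.Ventures.PercRepro2.HubTab3Data5
import Summits.Ventures.PercRepro2.HubTab3Data6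
import Summits.Ventures.PercRepro2.HubTab3Data7
import Summits.Ventures.PercRepro2.HubTab3Data8
import Summits.Ventures.PercRepro2.HubTab3Data9
import Summits.Ventures.PercRepro2.HubTab3Data10
import Summits.Ventures.PercRepro2.HubTab3Data12
import Summits.Ventures.PercRepro2.HubTab3Defs

/-!
# Kernel check of the a₃-hub table, part 8 of 18: type vectors 76–84
(blind cell PercRepro2, mine-2 g17)

For every type vector `n` of this part, the Kronecker hub number computed from the tables of the
twelve hub functions (`kronK'`, HubTab3.lean) equals the Kronecker number of the certified table
(`certK`, HubTab3Defs.lean) — one GMP computation per `n` (`decide +kernel`; `123` state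
triples in this part). With `kronK'_eq`, `kronK_eq` and `digits_unique_idxA` this is the table
identity `Wtot3 k (atoms t) = W_k(t)` digit by digit.
-/

namespace Summit.Ventures.PercRepro2.Hub3

set_option maxHeartbeats 0 in
set_option maxRecDepth 100000 in
/-- The a₃-hub table at the type vector `76` agrees with the Lean hub functions (kernel). -/
theorem check_76 : kronK' (decode4 76) = certK 76 := by decide +kernel

set_option maxHeartbeats 0 in
set_option maxRecDepth 100000 in
/-- The a₃-hub table at the type vector `77` agrees with the Lean hub functions (kernel). -/
theorem check_77 : kronK' (decode4 77) = certK 77 := by decide +kernel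

set_option maxHeartbeats 0 in
set_option maxRecDepth 100000 in
/-- The a₃-hub table at the type vector `78` agrees with the Lean hub functions (kernel). -/
theorem check_78 : kronK' (decode4 78) = certK 78 := by decide +kernel

set_option maxHeartbeats 0 in
set_option maxRecDepth 100000 in
/-- The a₃-hub table at the type vector `79` agrees with the Lean hub functions (kernel). -/
theorem check_79 : kronK' (decode4 79) = certK 79 := by decide +kernel

set_option maxHeartbeats 0 in
set_option maxRecDepth 100000 in
/-- The a₃-hub table at the type vector `80` agrees with the Lean hub functions (kernel). -/
theorem check_80 : kronK' (decode4 80) = certK 80 := by decide +kernel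

set_option maxHeartbeats 0 in
set_option maxRecDepth 100000 in
/-- The a₃-hub table at the type vector `81` agrees with the Lean hub functions (kernel). -/
theorem check_81 : kronK' (decode4 81) = certK 81 := by decide +kernel

set_option maxHeartbeats 0 in
set_option maxRecDepth 100000 in
/-- The a₃-hub table at the type vector `82` agrees with the Lean hub functions (kernel). -/
theorem check_82 : kronK' (decode4 82) = certK 82 := by decide +kernel

set_option maxHeartbeats 0 in
set_option maxRecDepth 100000 in
/-- The a₃-hub table at the type vector `83` agrees with the Lean hub functions (kernel). -/
theorem check_83 : kronK' (decode4 83) = certK 83 := by decide +kernel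

set_option maxHeartbeats 0 in
set_option maxRecDepth 100000 in
/-- The a₃-hub table at the type vector `84` agrees with the Lean hub functions (kernel). -/
theorem check_84 : kronK' (decode4 84) = certK 84 := by decide +kernel

end Summit.Ventures.PercRepro2.Hub3
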